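import Literature.Geometry.Lorentzian.KerrHawkingField

/-!
# `HawkingExtensionIsKerr` (crux `stmt-FinalStateConjecture-17840`): on the rotation AXIS the
# horizon Killing field is timelike for every spin, extremal included — the failure of the
# Killing–timelike collar at `a = M` is a band phenomenon invisible on the axis

Negative-lane anatomy lemma for the collar clause `∀ x ∈ U ∩ doc, g(K, K) < 0` of the crux
`HawkingExtensionIsKerr` (route `ZeroEnergyKerrOrBomb`; cdisprove seat, cycle 1), companion of
`ExtremalKerrNoCollar.lean` (same directory), which shows that at `a = M` the horizon Killing field
`K = T + ω₊ Φ` is SPACELIKE at equatorial exterior points arbitrarily close to `𝓗⁺ = {r = M}`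
(`g(K, K) = (r − M)²(r + 2M)/(4M²r)` on `{x₃ = 0}`), so that extreme Kerr carries no collar and the
collar clause is what keeps the degenerate member of the family out of the crux.

Here the complementary closed form ON THE AXIS `{x₁ = x₂ = 0}` is recorded, for ALL real `(M, a)`
and every constant angular velocity `c`:

  `g_{M,a}(T + cΦ, T + cΦ) = −Δ(r)/(r² + a²)`,  `Δ = r² − 2Mr + a²`    (`bilin_killingSpan_axis`),

since `Φ = x₁∂₂ − x₂∂₁` vanishes on the axis and `g_tt = −1 + 2Mr/(r² + a²cos²θ)` at `θ = 0`.  In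
particular for the Hawking field (`c = ω₊`) and extremal parameters `a = M > 0`:

  `g_{M,M}(K, K) = −(r − M)²/(r² + M²) < 0` off the horizon       (`bilin_hawkingVector_extremal_axis`,
                                                                  `…_neg`),

i.e. along the axis extreme Kerr DOES have a two-sided Killing–timelike collar.  Reading for the
crux and its idea cards (`degenerate-horizon-gauss-bonnet`, `degenerate-collar-gauss-law`): the
near-horizon coefficient `F(θ)` of `g(K, K) = r̃²F + O(r̃³)` on a vacuum degenerate horizon changes
sign between the poles (`F < 0`, this file) and the equator (`F > 0`, `ExtremalKerrNoCollar.lean`);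
an argument that inspects the generator only along the axis, or only its AVERAGE over a section
(`∫_S F dA = 8π > 0`), must still localise the positive set of `F` to produce the spacelike points
— the two files give the two endpoints `θ = 0`, `θ = π/2` of the band `sin θ > √3 − 1` in closed
form on the exact solution.  No hypothesis of the crux is weakened here; the lemma is the
sub-case bookkeeping for the load-bearing collar clause (tight at `a = M`, but only off-axis).

References: B. O'Neill, *The geometry of Kerr black holes* (1995), Ch. 2, §2.4 (`g_tt` in
Boyer–Lindquist form; the axis); M. Dafermos, I. Rodnianski, Y. Shlapentokh-Rothman,
arXiv:1402.7034, §2.2.2 (`K = T + ω₊Φ`); J. Bardeen, G. Horowitz, Phys. Rev. D 60 (1999) 104030,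
§2 (NHEK, `Λ(θ) = 2 sin θ/(1 + cos²θ)`, `Λ(0) = 0 < 1`).
-/

noncomputable section

namespace Summit.FinalStateConjecture.FinalStateConjecture.Theorems.HawkingExtensionIsKerr.Negative

open Literature.Geometry.Lorentzian Literature.Geometry.Lorentzian.Kerr

/-- On the rotation axis `{x₁ = x₂ = 0}` of the Kerr–Schild chart the radius is `|x₃|`:
`x₃² = r²` wherever `r > 0` (the level sets of `r` are the confocal ellipsoids
`(x₁² + x₂²)/(r² + a²) + x₃²/r² = 1`, `Kerr.sq_add_sq_eq`). Visser, arXiv:0706.0622, (35). [cite: arXiv07060622, (35)] -/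
theorem sq_apply_three_of_axis {a : ℝ} {x : E4} (hx1 : x 1 = 0) (hx2 : x 2 = 0)
    (hr : 0 < radius a x) : x 3 ^ 2 = radius a x ^ 2 := by
  have h := sq_add_sq_eq a hr
  rw [hx1, hx2] at h
  have h1 : radius a x ^ 2 + a ^ 2 ≠ 0 := by positivity
  have h2 : radius a x ^ 2 ≠ 0 := by positivity
  have h3 : (radius a x ^ 2 + a ^ 2) * (radius a x ^ 2 - x 3 ^ 2) = 0 := by
    have h4 : (radius a x ^ 2 + a ^ 2) * (radius a x ^ 2 - x 3 ^ 2) / radius a x ^ 2 = 0 := by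
      rw [← h]; ring
    rwa [div_eq_zero_iff, or_iff_left h2] at h4
  rcases mul_eq_zero.1 h3 with h4 | h4
  · exact absurd h4 h1
  · linarith

/-- **On the axis every field of the Killing span is `T`**: for all real `M, a, c`, at a point of
the axis `{x₁ = x₂ = 0}` with `r > 0`,
`g_{M,a}(T + cΦ, T + cΦ) = −Δ/(r² + a²) = −(r² − 2Mr + a²)/(r² + a²)` (`Φ = 0` there; this is
`g_tt` at `θ = 0`). O'Neill 1995, Ch. 2, §2.4. [cite: ONeill1995, Ch. 2 §2.4] -/
theorem bilin_killingSpan_axis (M a c : ℝ) {x : E4} (hx1 : x 1 = 0) (hx2 : x 2 = 0)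
    (hr : 0 < radius a x) :
    bilin M a x (E4.basisVector 0 + c • axialVector x) (E4.basisVector 0 + c • axialVector x) =
      -(radius a x ^ 2 - 2 * M * radius a x + a ^ 2) / (radius a x ^ 2 + a ^ 2) := by
  rw [bilin_basisVector_add_smul_axialVector M a c hr, sq_apply_three_of_axis hx1 hx2 hr]
  have h1 : radius a x ^ 2 + a ^ 2 ≠ 0 := by positivity
  have h2 : radius a x ≠ 0 := hr.ne'
  field_simp
  ring

/-- The Hawking field `K = T + ω₊Φ` on the axis: `g_{M,a}(K, K) = −Δ/(r² + a²)` for all real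
`M, a` (`r > 0`). DRSR arXiv:1402.7034, §2.2.2; O'Neill 1995, Ch. 2, §2.4. [cite: DafermosRodnianskiShlapentokhrothman2014, §2.2.2] -/
theorem bilin_hawkingVector_axis (M a : ℝ) {x : E4} (hx1 : x 1 = 0) (hx2 : x 2 = 0)
    (hr : 0 < radius a x) :
    bilin M a x (hawkingVector M a x) (hawkingVector M a x) =
      -(radius a x ^ 2 - 2 * M * radius a x + a ^ 2) / (radius a x ^ 2 + a ^ 2) :=
  bilin_killingSpan_axis M a _ hx1 hx2 hr

/-- **Extreme Kerr, rotation axis**: for `a = M`, at an axis point of radius `r > 0`,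
`g_{M,M}(K, K) = −(r − M)²/(r² + M²)` for the Hawking field `K = T + (1/2M) Φ` — the polar caps
are TIMELIKE to second order in `r − M`, in contrast with the equator where
`g(K, K) = (r − M)²(r + 2M)/(4M²r) > 0` (`bilin_hawkingVector_extremal_equatorial`,
`ExtremalKerrNoCollar.lean`): the two endpoints of the NHEK band `sin θ > √3 − 1`.
Bardeen–Horowitz 1999, §2; O'Neill 1995, Ch. 2, §2.4. [cite: ONeill1995, Ch. 2 §2.4] -/
theorem bilin_hawkingVector_extremal_axis (M : ℝ) {x : E4} (hx1 : x 1 = 0) (hx2 : x 2 = 0)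
    (hr : 0 < radius M x) :
    bilin M M x (hawkingVector M M x) (hawkingVector M M x) =
      -(radius M x - M) ^ 2 / (radius M x ^ 2 + M ^ 2) := by
  rw [bilin_hawkingVector_axis M M hx1 hx2 hr]
  ring

/-- On the axis of extreme Kerr the Hawking field is timelike at every point off the horizon
`{r = M}` (inside or outside), and null on it: `g_{M,M}(K, K) < 0` for `r > 0`, `r ≠ M`.  So along
the axis a two-sided Killing–timelike collar EXISTS at `a = M`; the absence of a collar
(`exists_spacelike_near_horizon_extremal`) is detected only off-axis. O'Neill 1995, Ch. 2, §2.4. [cite: ONeill1995, Ch. 2 §2.4] -/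
theorem bilin_hawkingVector_extremal_axis_neg (M : ℝ) {x : E4} (hx1 : x 1 = 0) (hx2 : x 2 = 0)
    (hr : 0 < radius M x) (hrM : radius M x ≠ M) :
    bilin M M x (hawkingVector M M x) (hawkingVector M M x) < 0 := by
  rw [bilin_hawkingVector_extremal_axis M hx1 hx2 hr]
  have h0 : radius M x - M ≠ 0 := sub_ne_zero.2 hrM
  have h1 : 0 < (radius M x - M) ^ 2 := lt_of_le_of_ne (sq_nonneg _) (Ne.symm (pow_ne_zero 2 h0))
  exact div_neg_of_neg_of_pos (neg_lt_zero.2 h1) (by positivity)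

/-- On the axis of extreme Kerr the Hawking field is null exactly on the horizon: `g(K, K) = 0` at
an axis point of radius `M`. O'Neill 1995, Ch. 2, §2.5. [cite: ONeill1995, Ch. 2 §2.5] -/
theorem bilin_hawkingVector_extremal_axis_horizon (M : ℝ) {x : E4} (hx1 : x 1 = 0) (hx2 : x 2 = 0)
    (hr : 0 < radius M x) (hrM : radius M x = M) :
    bilin M M x (hawkingVector M M x) (hawkingVector M M x) = 0 := by
  rw [bilin_hawkingVector_extremal_axis M hx1 hx2 hr, hrM]
  simp

end Summit.FinalStateConjecture.FinalStateConjecture.Theorems.HawkingExtensionIsKerr.Negative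

end
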